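/-
Origin: expansion seat `planner-pub-hodgecm-toy-g4-0`, handover #4 2026-08-18T13:13:00Z (md5 3ad013e8) (`HOME/pub-hodgecm-toy-g4/lean/ToyG4/NoTrTop3.lean`, md5 3ad013e8, 124 lines);
landed by the gen-8 packager in gate run 30 as `HodgeCM/Model/ToyG2/NoTrTop3.lean` (verbatim).
-/
/-
# T `Fact_trTop` FAILS in `toyUniverse₃ d t` — for every Hodge datum and every trace system

Generation 4 of the consistency-witness lineage (unit `pub-hodgecm-toy-g4`), file 4.  KERNEL; cites nothing, posits nothing.

`Universe.Fact_trTop` (T: on EVERY variety `X` the top-degree trace `∫_X : H^{2 dim X}(X, ℚ) → ℚ` is bijective,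
`StubTree/Qw8Monomial.lean`) is the binder of the primed end state `Assembly.COR_CM_of_genericFacts'`; the unprimed end
states consume only its CM-product restriction T-CM `Fact_trTopCM`, which HOLDS in `toyUniverse₃ d t`
(`ToyG2.toyUniverse₃_trTopCM`, generation 3, which records T itself as "not claimed, not to be expected").  This file turns
that remark into a theorem: **T is REFUTED in `toyModel3With D T (gplOf d t)` for EVERY Hodge datum `D` and EVERY trace
system `T`** (`not_fact3_trTop`), in particular in `toyUniverse₃ d t` (`not_toyUniverse₃_trTop`).

The witness is the period surface `pbObj P(L, ι₁)` (a good object, `good_pLeafOf`): it has `dim = 2` (`dim_pbObj`) but its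
`H¹`-lattice `L(P(L, ι₁)) = ⊕_{q ∈ Q(L,ι₁)} L(M_{Θ_q})` has rank `#Q(L, ι₁) · 4 [L:ℚ]` (`finrank_L_pLeafOf`), a multiple of
`8` (a CM field has even degree ≥ 2), never `4`; so `H⁴ = ⋀⁴ L` has dimension `C(rank, 4) ≠ 1` and NO linear functional on it
is bijective — whatever the trace.  (Generation 1 refuted T in the exterior model for the same kind of reason, `Toy.not_fact_trTop`
/ `Toy.Retrace.not_fact_trTop`: there the period surface has `H⁴ = 0`.)

With generation 3's `toyUniverse₃_trTopCM_all` and `toyUniverse₃_modelAxioms_all` (RUN 29, `TrTopAll3` / `SplitAllGood`) this gives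
the SEPARATION `exists_modelAxioms_trTopCM_not_trTop : ∃ U, U.ModelAxioms ∧ U.Fact_trTopCM ∧ ¬ U.Fact_trTop` — T-CM does not imply T,
even under all 28 model axioms (the converse `trTopCM_of_trTop` is in the tree).

Consequences for the ledger (`TOY-G4.md` §3): the binder list of `COR_CM_of_genericFacts'` (with T) has NO joint model in this
lineage and cannot have one in any re-tracing of `toyUniverse₃`; the binder lists with T-CM do (generation 3 + files 1–3 of
this generation).  T-CM is therefore the right repair of T, exactly as F6's content was repaired — an instance of the
"∀ X over a universe with degenerate varieties" artefact, not evidence against T for smooth projective varieties.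
-/
import Summits.HodgeConjecture.HodgeCM.Model.ToyG2.TrTopAll3

namespace HodgeCM.ToyG2

open Toy

/-! ## 1. Lattice ranks of iterated products and of the period leaf -/

/-- `rk L(∅) = 0` -/
theorem finrank_L_emptyObj : Module.finrank ℚ emptyObj.L = 0 := Module.finrank_zero_of_subsingleton

/-- `rk L(∏ₖ Bₖ) = m · c` when every factor has rank `c` -/
theorem finrank_L_prodFam_const (c : ℕ) : ∀ (m : ℕ) (B : Fin m → Obj), (∀ k, Module.finrank ℚ (B k).L = c) →
    Module.finrank ℚ (prodFam m B).L = m * c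
  | 0, _, _ => by rw [Nat.zero_mul]; exact finrank_L_emptyObj
  | m + 1, B, h => by
      change Module.finrank ℚ ((B 0).prod (prodFam m fun k => B k.succ)).L = (m + 1) * c
      rw [finrank_L_prod, h 0, finrank_L_prodFam_const c m _ fun k => h k.succ]
      ring

/-- **`rk L(P(L, ι₁)) = #Q(L, ι₁) · 4 [L:ℚ]`** -/
theorem finrank_L_pLeafOf (L : CMField) (ι₁ : (L : Type) →+* ℂ) (d t : ℚ) :
    Module.finrank ℚ (pLeafOf L ι₁ d t).O.L = nQ L ι₁ * (4 * Module.finrank ℚ (L : Type)) := by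
  rw [pLeafOf_O]
  exact finrank_L_prodFam_const _ _ _ fun k => finrank_L_PP L (ΘOf L ι₁ k)

/-- a CM field has degree at least `2` -/
theorem two_le_finrank_CMField (L : CMField) : 2 ≤ Module.finrank ℚ (L : Type) := by
  have h := NumberField.IsTotallyComplex.finrank (K := (L : Type))
  have h2 : 0 < Module.finrank ℚ (L : Type) := Module.finrank_pos
  omega

/-- hence `rk L(P(L, ι₁)) ≠ 4` -/
theorem finrank_L_pLeafOf_ne_four (L : CMField) (ι₁ : (L : Type) →+* ℂ) (d t : ℚ) :
    Module.finrank ℚ (pLeafOf L ι₁ d t).O.L ≠ 4 := by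
  rw [finrank_L_pLeafOf]
  have h2 := two_le_finrank_CMField L
  rcases Nat.eq_zero_or_pos (nQ L ι₁) with h0 | h0
  · rw [h0]; omega
  · intro h
    have : 1 * (4 * 2) ≤ nQ L ι₁ * (4 * Module.finrank ℚ (L : Type)) :=
      Nat.mul_le_mul h0 (Nat.mul_le_mul_left 4 h2)
    omega

/-! ## 2. No bijective functional on `⋀⁴` of a lattice of rank `≠ 4` -/

/-- `C(r, 4) = 1` forces `r = 4` -/
theorem eq_four_of_choose_four_eq_one {r : ℕ} (h : r.choose 4 = 1) : r = 4 := by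
  rcases Nat.lt_or_ge r 4 with hr | hr
  · rw [Nat.choose_eq_zero_of_lt hr] at h; exact absurd h zero_ne_one
  · rcases hr.eq_or_lt with hr | hr
    · exact hr.symm
    · have h5 : (5 : ℕ).choose 4 ≤ r.choose 4 := Nat.choose_le_choose 4 hr
      rw [h] at h5
      exact absurd h5 (by decide)

/-- if the lattice rank is not `4`, no functional `⋀⁴ L → ℚ` is bijective -/
theorem not_bijective_of_finrank_ne_four (O : Obj) (h : Module.finrank ℚ O.L ≠ 4)
    (φ : (↥(⋀[ℚ]^4 O.L)) →ₗ[ℚ] ℚ) : ¬ Function.Bijective φ := by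
  intro hφ
  haveI : Module.Free ℚ O.L := Module.Free.of_divisionRing ℚ _
  have e := (LinearEquiv.ofBijective φ hφ).finrank_eq
  rw [exteriorPower.finrank_eq, Module.finrank_self] at e
  exact h (eq_four_of_choose_four_eq_one e)

/-! ## 3. T fails -/

/-- **T fails on the good-object universe with the period blocks `P(L, ι₁)`, for every Hodge datum and every trace system**:
the period surface at any `(L, ι₁)` is a variety of dimension `2` whose `H⁴` is not a line. -/
theorem not_fact3_trTop (D : HodgeData) (T : TraceSys) (d t : ℚ) (L : CMField) (ι₁ : (L : Type) →+* ℂ) :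
    ¬ (toyModel3With D T (gplOf d t)).Fact_trTop := by
  intro hT
  let X₀ : GObj := ⟨pbObj (pLeafOf L ι₁ d t), good_pbObj (good_pLeafOf L ι₁ d t)⟩
  have hb := hT X₀
  change Function.Bijective (T.tr (pbObj (pLeafOf L ι₁ d t)) (2 * (pbObj (pLeafOf L ι₁ d t)).dim)) at hb
  have key : ∀ n, n = 4 → ¬ Function.Bijective (T.tr (pbObj (pLeafOf L ι₁ d t)) n) := by
    rintro n rfl
    exact not_bijective_of_finrank_ne_four (pLeafOf L ι₁ d t).O (finrank_L_pLeafOf_ne_four L ι₁ d t) _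
  exact key _ (by rw [dim_pbObj]) hb

/-- a CM field has a complex embedding -/
theorem nonempty_embedding (L : CMField) : Nonempty ((L : Type) →+* ℂ) := by
  apply Fintype.card_pos_iff.mp
  rw [NumberField.Embeddings.card]
  exact Module.finrank_pos

/-- **T `Fact_trTop` fails in `toyUniverse₃ d t`** (all `d t`; witness: the period surface at `ℚ(ζ₇)`, `Model/Inhabited.lean`'s `cyclo7`). -/
theorem not_toyUniverse₃_trTop (d t : ℚ) : ¬ (toyUniverse₃ d t).Fact_trTop := by
  obtain ⟨ι₁⟩ := nonempty_embedding cyclo7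
  exact not_fact3_trTop exteriorHodgeData traceSys d t cyclo7 ι₁

/-- **T-CM does not imply T, even under all 28 model axioms**: `toyUniverse₃ 1 4` has `ModelAxioms ∧ Fact_trTopCM ∧ ¬ Fact_trTop`
(the converse implication `Universe.trTopCM_of_trTop` holds everywhere). -/
theorem exists_modelAxioms_trTopCM_not_trTop : ∃ U : Universe, U.ModelAxioms ∧ U.Fact_trTopCM ∧ ¬ U.Fact_trTop :=
  ⟨toyUniverse₃ 1 4, toyUniverse₃_modelAxioms_all 1 4, toyUniverse₃_trTopCM_all 1 4, not_toyUniverse₃_trTop 1 4⟩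

end HodgeCM.ToyG2
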